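import Summits.AnomalousDissipation.AnomalousDissipation.Theorems.BaireTransferRobustLoudUpgradeLine
import Summits.AnomalousDissipation.AnomalousDissipation.Theorems.BaireTransferRobustLoudUpgradeStubCategoryTransfer

/-!
# Crux-strategist census v3, kernel-checked part — TEMPERED WINDOWS
# (crux `BaireTransfer.RobustLoudUpgrade`, stmt-AnomalousDissipation-1144; seat planner-cstrat-…-1144-s1-0, 2026-08-17)

Pure topology over the crux's vocabulary (`Coeff`, `force`, `loud` of `Theorems/BaireTransferRobustLoudUpgradeLine.lean`).
Nothing here is a line for the crux; it certifies the glue of the census's §Decomposition (D5) and of the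
route-level door (R5).  No `sorry`; the three analytic inputs enter as named `Prop`s (hypotheses), never asserted.

* `loudWin` — the TEMPERED WINDOW: witnesses with viscosity `ν ∈ [ν₁,ν₂]`, period `τ ∈ [τ₁,τ₂]` and a pointwise
  `C¹ₓ` bound `H` on the velocity; `win S a E ε n` the `n`-th standard window inside the ceiling `a`.
* `TemperedClosed` (Sub₁, theorem-grade: Arzelà–Ascoli + the quantitative parabolic ladder at fixed `ν > 0`),
  `WindowExhaust` (Sub₀, elementary: a jointly smooth periodic field is `C¹ₓ`-bounded), `LocallyNonMeagreLoud`
  (Sub₂: relaxed loudness is of second category near every loud force).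
* `RobustLoudUpgrade_of_subs : TemperedClosed → WindowExhaust → LocallyNonMeagreLoud → RobustLoudUpgrade` and the
  converse `locallyNonMeagreLoud_of_crux : RobustLoudUpgrade → LocallyNonMeagreLoud` (Baire only) — so Sub₂ is the
  crux in Baire-LARGENESS language, modulo Sub₀+Sub₁ (census: a reformulation, not a split with a leaf).
* ROUTE-LEVEL DOOR R5: `DenseTemperedLoud` (crux #2 with a level-uniform window near `U`) and
  `baireTarget_of_denseTempered : TemperedClosed → DenseTemperedLoud → BaireTarget` — with uniformly tempered
  designer witnesses the upgrade crux (and Baire) disappear: a closed dense subset of `U` is `U`.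
-/

set_option linter.dupNamespace false

noncomputable section

open scoped Topology
open Filter Set Function TopologicalSpace

namespace Summit.AnomalousDissipation.AnomalousDissipation.Cruxes.RobustLoudUpgrade.TemperedWindows

open Literature.Analysis.FunctionSpaces Literature.Analysis.FunctionSpaces.Torus
open Literature.Analysis.FluidPDE
open Summit.AnomalousDissipation.AnomalousDissipation.Theses.BaireTransfer
open Summit.AnomalousDissipation.AnomalousDissipation.Theorems.RobustLoudUpgrade

/-- The flat unit torus `T³`. -/
local notation "𝕋³" => UnitAddTorus (Fin 3)
/-- Real velocity values. -/
local notation "ℝ³" => EuclideanSpace ℝ (Fin 3)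

/-! ## §1 Tempered windows -/

/-- **Tempered window** `LOUD^{K}(S,E,ε)`, `K = [ν₁,ν₂] × [τ₁,τ₂] × {‖u‖_{C⁰} , ‖∂ᵢu‖_{C⁰} ≤ H}`: coefficient vectors
carrying a classical time-periodic witness whose viscosity, period and pointwise `C¹ₓ` size lie in the compact
window, with (closed) budgets `meanEnergy ≤ E`, `meanDissipation ≥ ε`. [folklore] -/
def loudWin (S : Finset (Fin 3 → ℤ)) (ν₁ ν₂ τ₁ τ₂ H E ε : ℝ) : Set (Coeff S) :=
  {c | ∃ ν : ℝ, ν₁ ≤ ν ∧ ν ≤ ν₂ ∧ ∃ (τ : ℝ) (u : ℝ → 𝕋³ → ℝ³) (p : ℝ → 𝕋³ → ℝ), τ₁ ≤ τ ∧ τ ≤ τ₂ ∧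
    IsClassicalNSSolutionOn Set.univ ν (fun _ => force S c) u p ∧ Function.Periodic u τ ∧
      (∀ t x, ‖u t x‖ ≤ H ∧ ∀ i, ‖partialDeriv i (u t) x‖ ≤ H) ∧
        meanEnergy u ≤ E ∧ ε ≤ meanDissipation ν u}

/-- The `n`-th standard tempered window inside the viscosity ceiling `a`:
`ν ∈ [a/(n+2), a(n+1)/(n+2)]`, `τ ∈ [1/(n+1), n+1]`, `H = n+1`. [folklore] -/
def win (S : Finset (Fin 3 → ℤ)) (a E ε : ℝ) (n : ℕ) : Set (Coeff S) :=
  loudWin S (a / ((n : ℝ) + 2)) (a * ((n : ℝ) + 1) / ((n : ℝ) + 2)) (1 / ((n : ℝ) + 1)) ((n : ℝ) + 1)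
    ((n : ℝ) + 1) E ε

/-- A standard window sits inside the loud set of its ceiling (`0 < a/(n+2) ≤ ν ≤ a(n+1)/(n+2) < a`, `τ ≥ 1/(n+1) > 0`). [folklore] -/
theorem win_subset_loud {S : Finset (Fin 3 → ℤ)} {a E ε : ℝ} (ha : 0 < a) (n : ℕ) :
    win S a E ε n ⊆ loud S a E ε := by
  rintro c ⟨ν, hν₁, hν₂, τ, u, p, hτ₁, _hτ₂, hsol, hper, _hH, hE, hε⟩
  have hn2 : (0 : ℝ) < (n : ℝ) + 2 := by positivity
  have hn1 : (0 : ℝ) < (n : ℝ) + 1 := by positivity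
  refine ⟨ν, ?_, ?_, τ, u, p, ?_, hsol, hper, hE, hε⟩
  · exact lt_of_lt_of_le (div_pos ha hn2) hν₁
  · have : a * ((n : ℝ) + 1) / ((n : ℝ) + 2) < a := by
      rw [div_lt_iff₀ hn2]; nlinarith
    exact lt_of_le_of_lt hν₂ this
  · exact lt_of_lt_of_le (one_div_pos.2 hn1) hτ₁

/-! ## §2 The three pieces of the census decomposition (D5), as named propositions -/

/-- **Sub₁ — TEMPERED WINDOWS ARE CLOSED** (theorem-grade; classical content: a `C¹ₓ`-bounded family of
time-periodic classical NS solutions at viscosities `≥ ν₁ > 0`, periods in `[τ₁,τ₂]`, forces `f_c` with `c` convergent,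
is precompact in `C^∞(ℝ × T³)` — quantitative parabolic regularity ladder + Arzelà–Ascoli — and limits are witnesses:
the PDE, periodicity, the tempering and the closed budget inequalities pass to the limit). [folklore] -/
def TemperedClosed : Prop :=
  ∀ (S : Finset (Fin 3 → ℤ)) (ν₁ ν₂ τ₁ τ₂ H E ε : ℝ), 0 < ν₁ → 0 < τ₁ → IsClosed (loudWin S ν₁ ν₂ τ₁ τ₂ H E ε)

/-- **Sub₀ — WINDOW EXHAUSTION** (elementary: `ν ∈ (0,a)` and `τ > 0` lie in some standard window, and a jointly smooth
time-periodic field on the compact `(ℝ/τℤ) × T³` has bounded velocity and first space derivatives). [folklore] -/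
def WindowExhaust : Prop :=
  ∀ (S : Finset (Fin 3 → ℤ)) (a E ε : ℝ), 0 < a → loud S a E ε ⊆ ⋃ n : ℕ, win S a E ε n

/-- **Sub₂ — RELAXED LOUDNESS IS OF SECOND CATEGORY NEAR EVERY LOUD FORCE** (the crux in Baire-largeness
language: `LOUD_j(S,2E,ε/2)` is non-meagre in every open neighbourhood of every point of `LOUD_j(S,E,ε)`). [folklore] -/
def LocallyNonMeagreLoud : Prop :=
  ∃ S₀ : Finset (Fin 3 → ℤ), ∀ S : Finset (Fin 3 → ℤ), S₀ ⊆ S → ∀ (E ε : ℝ), 0 < ε → ∀ j : ℕ,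
    ∀ c ∈ loud S (1 / ((j : ℝ) + 1)) E ε, ∀ V : Set (Coeff S), IsOpen V → c ∈ V →
      ¬ IsMeagre (loud S (1 / ((j : ℝ) + 1)) (2 * E) (ε / 2) ∩ V)

/-! ## §3 The glue of (D5), both directions -/

/-- Pointwise category lemma (any space): if `L = ⋃ₙ Kₙ` with all `Kₙ` closed and `L` is non-meagre in every open
neighbourhood of `c`, then `c ∈ closure (interior L)`. [folklore] -/
theorem mem_closure_interior_of_not_isMeagre {X : Type*} [TopologicalSpace X] {L : Set X} {K : ℕ → Set X}
    (hK : ∀ n, IsClosed (K n)) (hL : L = ⋃ n, K n) {c : X}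
    (h : ∀ V : Set X, IsOpen V → c ∈ V → ¬ IsMeagre (L ∩ V)) : c ∈ closure (interior L) := by
  by_contra hc
  set V : Set X := (closure (interior L))ᶜ with hV
  have hVo : IsOpen V := isClosed_closure.isOpen_compl
  have hcV : c ∈ V := hc
  have hdis : interior L ∩ V = ∅ :=
    Set.eq_empty_of_forall_notMem fun y hy => hy.2 (subset_closure hy.1)
  have hmeag : IsMeagre (L ∩ V) := by
    have e : L ∩ V = ⋃ n, (K n ∩ V) := by rw [hL, Set.iUnion_inter]
    rw [e]
    exact isMeagre_iUnion fun n =>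
      (CategoryTransfer.isNowhereDense_inter hdis (hK n) (hL ▸ Set.subset_iUnion K n)).isMeagre
  exact h V hVo hcV hmeag

/-- **(D5) glue**: `TemperedClosed → WindowExhaust → LocallyNonMeagreLoud → RobustLoudUpgrade`. [folklore] -/
theorem RobustLoudUpgrade_of_subs (h₁ : TemperedClosed) (h₀ : WindowExhaust) (h₂ : LocallyNonMeagreLoud) :
    RobustLoudUpgrade := by
  obtain ⟨S₀, hS₀⟩ := h₂
  refine ⟨S₀, fun S hS E ε hε j c hc => ?_⟩
  have ha : (0 : ℝ) < 1 / ((j : ℝ) + 1) := one_div_pos.2 (by positivity)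
  -- the relaxed loud set is the union of its (closed) standard windows
  have hL : loud S (1 / ((j : ℝ) + 1)) (2 * E) (ε / 2) = ⋃ n, win S (1 / ((j : ℝ) + 1)) (2 * E) (ε / 2) n :=
    Set.Subset.antisymm (h₀ S _ _ _ ha) (Set.iUnion_subset fun n => win_subset_loud ha n)
  have hK : ∀ n, IsClosed (win S (1 / ((j : ℝ) + 1)) (2 * E) (ε / 2) n) := fun n =>
    h₁ S _ _ _ _ _ _ _ (div_pos ha (by positivity)) (one_div_pos.2 (by positivity))
  exact mem_closure_interior_of_not_isMeagre hK hL (hS₀ S hS E ε hε j c hc)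

/-- **Converse (Baire only)**: the crux implies Sub₂ — a non-empty open subset of `P_S` is not meagre. [folklore] -/
theorem locallyNonMeagreLoud_of_crux (h : RobustLoudUpgrade) : LocallyNonMeagreLoud := by
  obtain ⟨S₀, hS₀⟩ := h
  refine ⟨S₀, fun S hS E ε hε j c hc V hVo hcV hmeag => ?_⟩
  have hcl : c ∈ closure (interior (loud S (1 / ((j : ℝ) + 1)) (2 * E) (ε / 2))) := hS₀ S hS E ε hε j hc
  obtain ⟨y, hyV, hyL⟩ := mem_closure_iff.1 hcl V hVo hcV
  have hWo : IsOpen (V ∩ interior (loud S (1 / ((j : ℝ) + 1)) (2 * E) (ε / 2))) := hVo.inter isOpen_interior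
  have hne : (V ∩ interior (loud S (1 / ((j : ℝ) + 1)) (2 * E) (ε / 2))).Nonempty := ⟨y, hyV, hyL⟩
  have hsub : V ∩ interior (loud S (1 / ((j : ℝ) + 1)) (2 * E) (ε / 2)) ⊆
      loud S (1 / ((j : ℝ) + 1)) (2 * E) (ε / 2) ∩ V := fun z hz => ⟨interior_subset hz.2, hz.1⟩
  exact not_isMeagre_of_isOpen hWo hne (hmeag.mono hsub)

/-! ## §4 Route-level door R5: uniformly tempered density makes the upgrade (and Baire) disappear -/

/-- **Crux #2 with a level-uniform tempered window near `U`** (what an explicit designer construction gives): for every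
stock `S₀` there are `S ⊇ S₀`, budgets and a non-empty open `U` such that at every level `j` ONE standard window `n = n(j)`
of `LOUD_j(S,E,ε)` is dense in `U`. [folklore] -/
def DenseTemperedLoud : Prop :=
  ∀ S₀ : Finset (Fin 3 → ℤ), ∃ S : Finset (Fin 3 → ℤ), S₀ ⊆ S ∧ ∃ (E ε : ℝ), 0 < ε ∧
    ∃ U : Set (Coeff S), IsOpen U ∧ U.Nonempty ∧
      ∀ j : ℕ, ∃ n : ℕ, U ⊆ closure (win S (1 / ((j : ℝ) + 1)) E ε n)

/-- **R5, strong form**: with uniformly tempered dense designer witnesses, EVERY force of `U` is loud at EVERY level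
(a closed set dense in `U` contains `U`) — no Baire category, no genericity, no nondegeneracy. [folklore] -/
theorem all_loud_of_denseTempered (h₁ : TemperedClosed) (h₂ : DenseTemperedLoud) :
    ∀ S₀ : Finset (Fin 3 → ℤ), ∃ S : Finset (Fin 3 → ℤ), S₀ ⊆ S ∧ ∃ (E ε : ℝ), 0 < ε ∧
      ∃ U : Set (Coeff S), IsOpen U ∧ U.Nonempty ∧ ∀ j : ℕ, U ⊆ loud S (1 / ((j : ℝ) + 1)) E ε := by
  intro S₀
  obtain ⟨S, hS, E, ε, hε, U, hUo, hUne, hU⟩ := h₂ S₀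
  refine ⟨S, hS, E, ε, hε, U, hUo, hUne, fun j => ?_⟩
  obtain ⟨n, hn⟩ := hU j
  have ha : (0 : ℝ) < 1 / ((j : ℝ) + 1) := one_div_pos.2 (by positivity)
  have hK : IsClosed (win S (1 / ((j : ℝ) + 1)) E ε n) :=
    h₁ S _ _ _ _ _ _ _ (div_pos ha (by positivity)) (one_div_pos.2 (by positivity))
  exact (hn.trans (hK.closure_subset)).trans (win_subset_loud ha n)

/-- **R5 ⇒ the route's target**: `TemperedClosed → DenseTemperedLoud → BaireTarget` (`U ⊆ LOUD_j` open ⇒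
`U ⊆ interior LOUD_j ⊆ closure (interior LOUD_j)`; the route's `LOUD_j` is `loud S (1/(j+1)) E ε` by `rfl`). [folklore] -/
theorem baireTarget_of_denseTempered (h₁ : TemperedClosed) (h₂ : DenseTemperedLoud) : BaireTarget := by
  obtain ⟨S, -, E, ε, hε, U, hUo, hUne, hU⟩ := all_loud_of_denseTempered h₁ h₂ ∅
  refine ⟨S, E, ε, hε, U, hUo, hUne, fun j => ?_⟩
  have h1 : U ⊆ interior (loud S (1 / ((j : ℝ) + 1)) E ε) := interior_maximal (hU j) hUo
  exact h1.trans subset_closure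

end Summit.AnomalousDissipation.AnomalousDissipation.Cruxes.RobustLoudUpgrade.TemperedWindows

end
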